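import Mathlib.RingTheory.AdjoinRoot
import Mathlib.RingTheory.LocalRing.ResidueField.Ideal
import Mathlib.RingTheory.LocalRing.RingHom.Basic
import Mathlib.RingTheory.Ideal.GoingUp
import Mathlib.RingTheory.Flat.Stability
import Mathlib.RingTheory.Flat.Localization
import Mathlib.RingTheory.Polynomial.Quotient
import Mathlib.Algebra.Polynomial.Lifts
import Mathlib.FieldTheory.IntermediateField.Adjoin.Basic
import Mathlib.FieldTheory.IntermediateField.Adjoin.Algebra
import Mathlib.RingTheory.Algebraic.Basic
import HarnessLib

/-!
# Flat local extensions with prescribed residue field extension (Stacks Project, Tag 03C3)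

The Stacks Project, Tag 03C3 (Algebra, Lemma "flat local ring map with given residue field
extension"), printed statement:

> Let `(R, 𝔪, k)` be a local ring. Let `K/k` be a field extension. There exists a local ring
> `(R', 𝔪', k')`, a flat local ring map `R → R'` such that `𝔪' = 𝔪R'` and such that `k'` is
> isomorphic to `K` as an extension of `k`.

This is EGA 0_III (10.3.1) ("gonflement" of a local ring along a residue field extension). The
printed proof treats a monogenic extension `k' = k(α)` first — "if `α` is transcendental over `k`,
then we let `R'` be the localization of `R[x]` at the prime `𝔪R[x]`; if `α` is algebraic with
minimal polynomial `T^d + ∑ λ̄_i T^{d-i}`, then we let `R' = R[T]/(T^d + ∑ λ_i T^{d-i})`" — and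
then runs a transfinite recursion over a well-ordering of `K`.

This file PROVES the finitely generated case, in the EMBEDDING form that its consumer needs
(`Literature/AlgebraicGeometry/Morphisms/SteinFactorizationReduction.lean`, the reduction of
Zariski's connectedness theorem to the lifting of idempotents, where only finitely generated
subextensions occur and only an embedding `K ↪ k'` over `k` is used):

* `exists_flat_local_step_of_isIntegral` — the algebraic monogenic step. For `j : F → κ(C)` a
  field embedded in the residue field of a local ring `C` and `a` algebraic over `F` (inside an
  ambient field `K ⊇ F`): with `μ` the minimal polynomial of `a`, `q̄` a monic irreducible factor
  of `j(μ)` in `κ(C)[X]` and `q ∈ C[X]` a monic lift, `C' = C[X]/(q)` is free over `C`, local with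
  maximal ideal `𝔪C'` (its quotient `C'/𝔪C' = κ(C)[X]/(q̄)` is a field, and every maximal ideal
  of the integral extension `C'` contracts to `𝔪`), and `F(a) = F[X]/(μ) → κ(C)[X]/(q̄) = κ(C')`,
  `a ↦ x̄`, extends `j`. (The printed proof takes `q̄ = j(μ)` itself, which is allowed there because
  `k' ⊆ K` is realised exactly; for an embedding any irreducible factor does.)
* `exists_flat_local_step_of_transcendental` — the transcendental monogenic step:
  `C' = C[X]_{𝔪C[X]}` (flat: `C[X]` is free and localizations are flat), residue field
  `Frac(κ(C)[X])`, into which `F(a) = Frac(F[a]) ≅ Frac(F[X])` embeds via `j`.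
* `exists_flat_local_step` — either case.
* `exists_flat_local_residueField_embedding` — **Tag 03C3, finitely generated case, embedding
  form**: for `C` local with residue field `k`, `K ⊇ k` a field and `s ⊆ K` finite, there is a
  flat local `C`-algebra `C'` with `C → C'` local and a `k`-embedding `k(s) ↪ κ(C')`; by induction
  on `s`, composing the monogenic steps (flat ∘ flat is flat, local ∘ local is local).

Deliberately NOT here: the equality `𝔪' = 𝔪C'` as a recorded conclusion (it holds for both
constructions but is not consumed), the isomorphism `k' ≅ K` (only an embedding of a finitely
generated subextension is produced), and the transfinite recursion for arbitrary `K`.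

## References

* The Stacks Project, Tag 03C3 (Algebra, Lemma `lemma-flat-local-given-residue-field`).
  [StacksProject]
* A. Grothendieck, J. Dieudonné, EGA III₁ (Publ. Math. IHÉS 11, 1961), Chap. 0, (10.3.1).
  [EGAIII1]
-/

noncomputable section

open Polynomial IsLocalRing

universe u

namespace Literature.RingTheory.Flat

open scoped IntermediateField.algebraAdjoinAdjoin

/-- **Monogenic step, algebraic case** (The Stacks Project, Tag 03C3, first paragraph of the
proof: "if `α` is algebraic with minimal polynomial `T^d + ∑ λ̄_i T^{d-i}`, then we let
`R' = R[T]/(T^d + ∑ λ_i T^{d-i})`"). Let `C` be a local ring, `j : F → κ(C)` a field embedded in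
its residue field, `K ⊇ F` a field and `a ∈ K` algebraic over `F`. Then there is a `C`-algebra `C'`
which is local, flat over `C`, with `C → C'` local, and a ring map `j' : F(a) → κ(C')` extending
`j` (i.e. `j' ∘ (F → F(a)) = (κ(C) → κ(C')) ∘ j`, stated element-wise through `C → κ(C)`).
Construction: `C' = C[X]/(q)` for a monic lift `q` of a monic irreducible factor `q̄` of `j(μ)`,
`μ` the minimal polynomial of `a`; `C'` is free over `C`, its ideal `𝔪C'` has quotient the field
`κ(C)[X]/(q̄)` (Mathlib `AdjoinRoot.quotEquivQuotMap`) and is its only maximal ideal since `C'` is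
integral over `C`; `j'` is `F(a) ≅ F[X]/(μ) → κ(C)[X]/(q̄) ≅ C'/𝔪C'`, `a ↦ X`.
[cite: StacksProject, Tag 03C3 (Algebra, proof, monogenic algebraic case)] -/
theorem exists_flat_local_step_of_isIntegral (C : Type u) [CommRing C] [IsLocalRing C]
    {F : Type u} [Field F] {K : Type u} [Field K] [Algebra F K] (j : F →+* ResidueField C)
    (a : K) (ha : IsIntegral F a) :
    ∃ (C' : Type u) (_ : CommRing C') (_ : IsLocalRing C') (_ : Algebra C C'),
      Module.Flat C C' ∧ IsLocalHom (algebraMap C C') ∧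
      ∃ j' : IntermediateField.adjoin F {a} →+* ResidueField C',
        ∀ (x : F) (c : C), j x = residue C c →
          j' (algebraMap F _ x) = residue C' (algebraMap C C' c) := by
  classical
  -- the minimal polynomial, an irreducible factor of its image, a monic lift
  set μ := minpoly F a with hμ
  set μ' : (ResidueField C)[X] := μ.map j with hμ'
  have hμ'0 : μ' ≠ 0 := (Polynomial.map_ne_zero_iff j.injective).mpr (minpoly.ne_zero ha)
  have hμ'u : ¬ IsUnit μ' := by
    intro h
    have h1 : μ'.degree = 0 := Polynomial.degree_eq_zero_of_isUnit h
    have h2 : μ'.degree = μ.degree := Polynomial.degree_map_eq_of_injective j.injective μ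
    have h3 := minpoly.degree_pos ha
    rw [← hμ, ← h2, h1] at h3
    exact lt_irrefl _ h3
  obtain ⟨q₀, hq₀, hq₀μ⟩ := WfDvdMonoid.exists_irreducible_factor hμ'u hμ'0
  have hq₀0 : q₀ ≠ 0 := hq₀.ne_zero
  set qb : (ResidueField C)[X] := q₀ * Polynomial.C (leadingCoeff q₀)⁻¹ with hqb
  have hqbirr : Irreducible qb := Polynomial.irreducible_mul_leadingCoeff_inv.mpr hq₀
  have hqbmon : qb.Monic := Polynomial.monic_mul_leadingCoeff_inv hq₀0
  have hqbμ : qb ∣ μ' := by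
    rw [hqb, IsUnit.mul_right_dvd]
    · exact hq₀μ
    · exact Polynomial.isUnit_C.mpr
        (IsUnit.mk0 _ (inv_ne_zero (Polynomial.leadingCoeff_ne_zero.mpr hq₀0)))
  obtain ⟨q, hqmap, -, hqmon⟩ := Polynomial.lifts_and_degree_eq_and_monic
    (Polynomial.mem_lifts_of_surjective residue_surjective qb) hqbmon
  -- the ring `C' = C[X]/(q)`
  haveI hfact : Fact (Irreducible qb) := ⟨hqbirr⟩
  let C' := AdjoinRoot q
  haveI : Module.Free C C' := Module.Free.of_basis (AdjoinRoot.powerBasis' hqmon).basis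
  haveI : Module.Finite C C' := (AdjoinRoot.powerBasis' hqmon).finite
  -- its unique maximal ideal
  set M0 : Ideal C' := (maximalIdeal C).map (AdjoinRoot.of q) with hM0
  let e₁ := AdjoinRoot.quotEquivQuotMap q (maximalIdeal C)
  have hqmap' : q.map (Ideal.Quotient.mk (maximalIdeal C)) = qb := hqmap
  have hfield : IsField ((ResidueField C)[X] ⧸
      Ideal.span {q.map (Ideal.Quotient.mk (maximalIdeal C))}) := by
    rw [hqmap']
    exact Field.toIsField (AdjoinRoot qb)
  have hM0max : M0.IsMaximal :=
    Ideal.Quotient.maximal_of_isField _ (MulEquiv.isField hfield e₁.toMulEquiv)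
  haveI hloc : IsLocalRing C' := by
    refine IsLocalRing.of_unique_max_ideal ⟨M0, hM0max, fun M hM ↦ ?_⟩
    have h1 : (M.comap (algebraMap C C')).IsMaximal :=
      Ideal.isMaximal_comap_of_isIntegral_of_isMaximal M
    have h2 : M.comap (algebraMap C C') = maximalIdeal C := IsLocalRing.eq_maximalIdeal h1
    have h3 : M0 ≤ M := by
      rw [hM0, ← AdjoinRoot.algebraMap_eq, Ideal.map_le_iff_le_comap, h2]
    exact (hM0max.eq_of_le hM.ne_top h3).symm
  have hmax : M0 = maximalIdeal C' := IsLocalRing.eq_maximalIdeal hM0max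
  have hlochom : IsLocalHom (algebraMap C C') :=
    ((IsLocalRing.local_hom_TFAE (algebraMap C C')).out 2 0).mp
      (by rw [AdjoinRoot.algebraMap_eq, ← hM0, hmax])
  -- the embedding of `F⟮a⟯`
  have hroot : μ.eval₂ ((AdjoinRoot.of qb).comp j) (AdjoinRoot.root qb) = 0 := by
    rw [← Polynomial.eval₂_map, ← hμ']
    obtain ⟨r, hr⟩ := hqbμ
    rw [hr, Polynomial.eval₂_mul, AdjoinRoot.eval₂_root, zero_mul]
  let j₁ : AdjoinRoot μ →+* AdjoinRoot qb := AdjoinRoot.lift ((AdjoinRoot.of qb).comp j) _ hroot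
  let j₂ : AdjoinRoot qb ≃+* (ResidueField C)[X] ⧸
      Ideal.span {q.map (Ideal.Quotient.mk (maximalIdeal C))} :=
    Ideal.quotEquivOfEq (by rw [hqmap']; rfl)
  let j₃ : C' ⧸ M0 ≃+* ResidueField C' := Ideal.quotEquivOfEq hmax
  let j' : IntermediateField.adjoin F {a} →+* ResidueField C' :=
    j₃.toRingHom.comp (e₁.symm.toRingEquiv.toRingHom.comp (j₂.toRingHom.comp (j₁.comp
      (IntermediateField.adjoinRootEquivAdjoin F ha).symm.toAlgHom.toRingHom)))
  refine ⟨C', inferInstance, hloc, inferInstance, inferInstance, hlochom, j', fun x c hx ↦ ?_⟩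
  change j₃ (e₁.symm (j₂ (j₁ ((IntermediateField.adjoinRootEquivAdjoin F ha).symm
    (algebraMap F _ x))))) = _
  rw [AlgEquiv.commutes, AdjoinRoot.algebraMap_eq, AdjoinRoot.lift_of, RingHom.comp_apply, hx]
  have e1 : j₂ (AdjoinRoot.of qb (residue C c)) = Ideal.Quotient.mk _
      ((Polynomial.C c).map (Ideal.Quotient.mk (maximalIdeal C))) := by
    rw [Polynomial.map_C]
    rfl
  rw [e1, AdjoinRoot.quotEquivQuotMap_symm_apply_mk]
  rfl

/-- **Monogenic step, transcendental case** (The Stacks Project, Tag 03C3, first paragraph of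
the proof: "if `α` is transcendental over `k`, then we let `R'` be the localization of `R[x]` at
the prime `𝔪R[x]`"). For `C` local, `j : F → κ(C)`, `K ⊇ F` and `a ∈ K` transcendental over `F`:
`C' = C[X]_{𝔪C[X]}` is local, flat over `C` (`C[X]` is free over `C`, a localization is flat),
`C → C'` is local (`𝔪 ⊆ 𝔪C[X]`), and `F(a) = Frac(F[a]) ≅ Frac(F[X]) → Frac(κ(C)[X]) = κ(𝔪C[X])
= κ(C')` (through `j`, injective) extends `j`.
[cite: StacksProject, Tag 03C3 (Algebra, proof, monogenic transcendental case)] -/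
theorem exists_flat_local_step_of_transcendental (C : Type u) [CommRing C] [IsLocalRing C]
    {F : Type u} [Field F] {K : Type u} [Field K] [Algebra F K] (j : F →+* ResidueField C)
    (a : K) (ha : Transcendental F a) :
    ∃ (C' : Type u) (_ : CommRing C') (_ : IsLocalRing C') (_ : Algebra C C'),
      Module.Flat C C' ∧ IsLocalHom (algebraMap C C') ∧
      ∃ j' : IntermediateField.adjoin F {a} →+* ResidueField C',
        ∀ (x : F) (c : C), j x = residue C c →
          j' (algebraMap F _ x) = residue C' (algebraMap C C' c) := by
  classical
  set P : Ideal C[X] := (maximalIdeal C).map (Polynomial.C : C →+* C[X]) with hP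
  haveI hPprime : P.IsPrime := Ideal.isPrime_map_C_of_isPrime
  let C' := Localization.AtPrime P
  haveI : Module.Flat C[X] C' := IsLocalization.flat C' P.primeCompl
  have hflat : Module.Flat C C' := Module.Flat.trans C C[X] C'
  have hlochom : IsLocalHom (algebraMap C C') := by
    refine ((IsLocalRing.local_hom_TFAE (algebraMap C C')).out 3 0).mp fun c hc ↦ ?_
    rw [Ideal.mem_comap, IsScalarTower.algebraMap_apply C C[X] C',
      IsLocalization.AtPrime.to_map_mem_maximal_iff C' P, Polynomial.algebraMap_eq]
    exact Ideal.mem_map_of_mem _ hc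
  -- the embedding `F(a) → κ(P) = Frac(κ[X])`
  let e₂ : (ResidueField C)[X] ≃+* C[X] ⧸ P :=
    Ideal.polynomialQuotientEquivQuotientPolynomial (maximalIdeal C)
  let θ : F[X] →+* ResidueField C' :=
    (algebraMap (C[X] ⧸ P) P.ResidueField).comp (e₂.toRingHom.comp (Polynomial.mapRingHom j))
  have hθ : Function.Injective θ := by
    refine (IsFractionRing.injective (C[X] ⧸ P) P.ResidueField).comp ?_
    exact e₂.injective.comp (Polynomial.map_injective j j.injective)
  let θ' : Algebra.adjoin F {a} →+* ResidueField C' :=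
    θ.comp (Polynomial.algEquivOfTranscendental F a ha).symm.toAlgHom.toRingHom
  have hθ' : Function.Injective θ' :=
    hθ.comp (Polynomial.algEquivOfTranscendental F a ha).symm.injective
  let j' : IntermediateField.adjoin F {a} →+* ResidueField C' := IsFractionRing.lift hθ'
  refine ⟨C', inferInstance, inferInstance, inferInstance, hflat, hlochom, j', fun x c hx ↦ ?_⟩
  rw [IsScalarTower.algebraMap_apply F (Algebra.adjoin F {a}) (IntermediateField.adjoin F {a}),
    IsFractionRing.lift_algebraMap]
  change θ ((Polynomial.algEquivOfTranscendental F a ha).symm (algebraMap F _ x)) = _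
  rw [AlgEquiv.commutes, Polynomial.algebraMap_eq]
  change algebraMap (C[X] ⧸ P) P.ResidueField (e₂ ((Polynomial.C x).map j)) = _
  rw [Polynomial.map_C, hx, show Polynomial.C (residue C c) =
      (Polynomial.C c).map (Ideal.Quotient.mk (maximalIdeal C)) by rw [Polynomial.map_C]; rfl]
  change algebraMap (C[X] ⧸ P) P.ResidueField
    (Ideal.polynomialQuotientEquivQuotientPolynomial (maximalIdeal C)
      ((Polynomial.C c).map (Ideal.Quotient.mk (maximalIdeal C)))) = _
  rw [Ideal.polynomialQuotientEquivQuotientPolynomial_map_mk,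
    Ideal.algebraMap_quotient_residueField_mk]
  change residue C' (algebraMap C[X] C' (Polynomial.C c)) = residue C' (algebraMap C C' c)
  rw [IsScalarTower.algebraMap_apply C C[X] C', Polynomial.algebraMap_eq]

/-- **Monogenic step** of Tag 03C3 (either case of `exists_flat_local_step_of_isIntegral`,
`exists_flat_local_step_of_transcendental`): adjoining one element `a ∈ K` to a field `F`
embedded in the residue field of a local ring `C` is realised, up to embedding, by the residue
field of a flat local `C`-algebra `C'` with `C → C'` local.
[cite: StacksProject, Tag 03C3 (Algebra, proof, first paragraph)] -/
theorem exists_flat_local_step (C : Type u) [CommRing C] [IsLocalRing C]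
    {F : Type u} [Field F] {K : Type u} [Field K] [Algebra F K] (j : F →+* ResidueField C)
    (a : K) :
    ∃ (C' : Type u) (_ : CommRing C') (_ : IsLocalRing C') (_ : Algebra C C'),
      Module.Flat C C' ∧ IsLocalHom (algebraMap C C') ∧
      ∃ j' : IntermediateField.adjoin F {a} →+* ResidueField C',
        ∀ (x : F) (c : C), j x = residue C c →
          j' (algebraMap F _ x) = residue C' (algebraMap C C' c) := by
  by_cases ha : IsIntegral F a
  · exact exists_flat_local_step_of_isIntegral C j a ha
  · exact exists_flat_local_step_of_transcendental C j a fun h ↦ ha h.isIntegral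

/-- **Flat local ring maps with prescribed residue field extension — finitely generated case,
embedding form** (The Stacks Project, Tag 03C3: "Let `(R, 𝔪, k)` be a local ring. Let `K/k` be a
field extension. There exists a local ring `(R', 𝔪', k')`, a flat local ring map `R → R'` such
that `𝔪' = 𝔪R'` and such that `k'` is isomorphic to `K` as an extension of `k`"; EGA 0_III
(10.3.1)). Recorded form: for a local ring `C` with residue field `k`, a field `K ⊇ k` and a finite
set `s ⊆ K`, there is a flat local `C`-algebra `C'` with `C → C'` a local homomorphism and a ring
map `j' : k(s) → κ(C')` with `j' ∘ (k → k(s)) = (κ(C) → κ(C'))`, i.e. an embedding of the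
finitely generated subextension `k(s)` into the residue field of `C'` over `k`. Proof: induction
on `s`, composing the monogenic steps `exists_flat_local_step` (the printed proof's transfinite
recursion, cut off at a finite stage); flatness and locality are stable under composition.
[cite: StacksProject, Tag 03C3 (Algebra, Lemma lemma-flat-local-given-residue-field, finitely generated case)] -/
theorem exists_flat_local_residueField_embedding (C : Type u) [CommRing C] [IsLocalRing C]
    {K : Type u} [Field K] [Algebra (ResidueField C) K] (s : Finset K) :
    ∃ (C' : Type u) (_ : CommRing C') (_ : IsLocalRing C') (_ : Algebra C C'),
      Module.Flat C C' ∧ IsLocalHom (algebraMap C C') ∧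
      ∃ j' : IntermediateField.adjoin (ResidueField C) (s : Set K) →+* ResidueField C',
        ∀ c : C, j' (algebraMap (ResidueField C) _ (residue C c)) =
          residue C' (algebraMap C C' c) := by
  classical
  induction s using Finset.induction_on with
  | empty =>
    have hbot : IntermediateField.adjoin (ResidueField C) ((∅ : Finset K) : Set K) = ⊥ := by
      rw [Finset.coe_empty, IntermediateField.adjoin_empty]
    let j' : IntermediateField.adjoin (ResidueField C) ((∅ : Finset K) : Set K) →+*
        ResidueField C :=
      (IntermediateField.botEquiv (ResidueField C) K).toAlgHom.toRingHom.comp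
        (IntermediateField.equivOfEq hbot).toAlgHom.toRingHom
    refine ⟨C, inferInstance, inferInstance, inferInstance, inferInstance, ⟨fun _ h ↦ h⟩, j',
      fun c ↦ ?_⟩
    change IntermediateField.botEquiv (ResidueField C) K
      (IntermediateField.equivOfEq hbot (algebraMap (ResidueField C) _ (residue C c))) = _
    rw [AlgEquiv.commutes, IntermediateField.botEquiv_def]
    rfl
  | insert a s _ ih =>
    obtain ⟨C₁, _, _, _, hflat₁, hloc₁, j₁, hj₁⟩ := ih
    obtain ⟨C₂, _, _, _, hflat₂, hloc₂, j₂, hj₂⟩ := exists_flat_local_step C₁ j₁ a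
    letI : Algebra C C₂ := ((algebraMap C₁ C₂).comp (algebraMap C C₁)).toAlgebra
    haveI : IsScalarTower C C₁ C₂ := IsScalarTower.of_algebraMap_eq fun _ ↦ rfl
    have hLa : IntermediateField.adjoin (ResidueField C) ((insert a s : Finset K) : Set K) =
        (IntermediateField.adjoin (IntermediateField.adjoin (ResidueField C) (s : Set K))
          {a}).restrictScalars (ResidueField C) := by
      rw [Finset.coe_insert, ← Set.union_singleton, IntermediateField.adjoin_adjoin_left]
    have hmem : ∀ x : K, x ∈ IntermediateField.adjoin (ResidueField C)
        ((insert a s : Finset K) : Set K) →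
        x ∈ IntermediateField.adjoin (IntermediateField.adjoin (ResidueField C) (s : Set K))
          {a} := by
      intro x hx
      rwa [hLa, IntermediateField.mem_restrictScalars] at hx
    let ε : IntermediateField.adjoin (ResidueField C) ((insert a s : Finset K) : Set K) →+*
        IntermediateField.adjoin (IntermediateField.adjoin (ResidueField C) (s : Set K)) {a} :=
      { toFun := fun x ↦ ⟨x.1, hmem x.1 x.2⟩
        map_one' := rfl
        map_mul' := fun _ _ ↦ rfl
        map_zero' := rfl
        map_add' := fun _ _ ↦ rfl }
    refine ⟨C₂, inferInstance, inferInstance, inferInstance, Module.Flat.trans C C₁ C₂,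
      RingHom.isLocalHom_comp _ _, j₂.comp ε, fun c ↦ ?_⟩
    have hε : ε (algebraMap (ResidueField C) _ (residue C c)) =
        algebraMap (IntermediateField.adjoin (ResidueField C) (s : Set K)) _
          (algebraMap (ResidueField C) (IntermediateField.adjoin (ResidueField C) (s : Set K))
            (residue C c)) := Subtype.ext rfl
    rw [RingHom.comp_apply, hε, hj₂ _ (algebraMap C C₁ c) (hj₁ c)]
    rfl

end Literature.RingTheory.Flat

end
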